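import Summits.HubbardSuperconductivity.HubbardSuperconductivity.Theorems.FunctionFieldCertificateNecessaryPoleOrderHubbardTwist
import Literature.MathematicalPhysics.QuantumLattice.PairFieldMomentum
import Literature.MathematicalPhysics.QuantumLattice.DWaveSourceProofs
import Literature.MathematicalPhysics.QuantumLattice.HubbardLSMFillingProofs
import Literature.MathematicalPhysics.QuantumLattice.TorusCooperSum
import HarnessLib

/-!
# Route `FunctionFieldCertificate` — support item `NecessaryPoleOrder`
# (stmt-HubbardSuperconductivity-7792): the pair field under a `U(1)` momentum boost

Second, model-specific input of the route's necessary-pole lemma (the "left-hand side" of its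
proof sketch): conjugating the `d`-wave pair field by the gauge transformation
`W_k = orbitalPhase (x, σ) ↦ χ_k(x)` (`χ_k` the character of `(ℤ/Lℤ)²`; for `k = (j, 0)` this is
the Lieb–Schultz–Mattis twist `exp(2πi j Σ_x x₁ n_x / L)`) BOOSTS the pair momentum by `2k`
(pairs carry charge `2`) up to a bond correction of relative size `|χ_k(e₁) - 1| = O(j/L)`:

* `ffc_boost_conj_localPair` — `W_k P_x W_kᴴ = conj χ_{2k}(x) • (P_x + C_x)` with the bond
  correction `C_x = Σ_e (g e/√2)(conj χ_k(e) - 1) b_{x,x+e}`;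
* `ffc_boost_conj_pairField` — `W_k Δ_g W_kᴴ = Δ_g(2k) + Σ_x conj χ_{2k}(x) • C_x`
  (`Δ_g(m) = pairFieldAt g L m`);
* `ffc_norm_boostCorrection_le` — `‖Σ_x conj χ_{2k}(x) • C_x‖ ≤ L² · 2 Σ_e |g e/√2| ‖χ_k(e) - 1‖`;
* `ffc_twisted_pairOrder_le` — for every Fock vector `ψ`,
  `L⁻⁴ ‖Δ_g W_kᴴ ψ‖² ≤ 2 S_ψ(2k) / L² + 2 (2 Σ_e |g e/√2| ‖χ_k(e) - 1‖)² ‖ψ‖²`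
  (`S_ψ = pairStructureFactor`): the `k = 0` pair order of a boosted state is controlled by the
  pair structure factor at `2k`, whose sum over momenta is `≤ 32 L²` (`sum_pairStructureFactor`);
  the averaging over the Lieb–Schultz–Mattis windings `k = (j, 0)` is the companion file
  `FunctionFieldCertificateNecessaryPoleOrderLsmBoosts.lean`.

Pure operator bookkeeping on the Jordan–Wigner matrices of the tree (`orbitalPhase_conj_annihilation`,
`localPair_eq_sum_bondPair`, `pairFieldAt_eq_sum_torusChar`, `torusChar_add_*`); no definition is
introduced. References: E. H. Lieb, T. Schultz, D. Mattis, Ann. Phys. 16 (1961) 407, App. B;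
H. Tasaki, J. Stat. Phys. 170 (2018) 653, §2.2; route thesis `Theses/FunctionFieldCertificate.lean`
(item 7792) and `Theses/GSCertificate.lean` (item 0407).
-/

namespace Summit.HubbardSuperconductivity.HubbardSuperconductivity.Theorems

-- the problem namespace `HubbardSuperconductivity.HubbardSuperconductivity` is the tree's layout (D-0017)
set_option linter.dupNamespace false

open Matrix Finset Literature.MathematicalPhysics.QuantumLattice Literature.Probability.LatticeModels
  Literature.Barriers.HubbardSuperconductivity
open scoped Matrix.Norms.L2Operator ComplexOrder ComplexConjugate

section Boost

variable (L : ℕ) [NeZero L]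

/-- The boost phases `(x, σ) ↦ χ_k(x)` have modulus one. [folklore] -/
theorem ffc_norm_boostPhase (k : TorusSite 2 L) (i : Orb (FermionTorus 2 L)) :
    ‖torusChar k (FermionTorus.toTorusSite (ofLex i).1)‖ = 1 :=
  norm_torusChar _ _

/-- `χ_{k+k'}(x) = χ_k(x) χ_{k'}(x)`. [folklore] -/
theorem ffc_torusChar_add_left (k k' x : TorusSite 2 L) :
    torusChar (k + k') x = torusChar k x * torusChar k' x := by
  rw [torusChar_comm, torusChar_add_right, torusChar_comm x k, torusChar_comm x k']

/-- **Boost of an annihilation operator**: `W_k c_{uσ} W_kᴴ = conj χ_k(u) • c_{uσ}`.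
[cite: LiebSchultzMattisAP1961, Appendix B] -/
theorem ffc_boost_conj_annihilation (k u : TorusSite 2 L) (σ : Fin 2) :
    orbitalPhase (fun i : Orb (FermionTorus 2 L) => torusChar k (FermionTorus.toTorusSite (ofLex i).1)) *
        annihilation (orb (FermionTorus.ofTorusSite u) σ) *
      (orbitalPhase (fun i : Orb (FermionTorus 2 L) =>
        torusChar k (FermionTorus.toTorusSite (ofLex i).1)))ᴴ =
      conj (torusChar k u) • annihilation (orb (FermionTorus.ofTorusSite u) σ) := by
  rw [orbitalPhase_conj_annihilation (ffc_norm_boostPhase L k)]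
  simp [orb]

/-- **Boost of a singlet bond pair**: `W_k b_{uv} W_kᴴ = conj χ_k(u) conj χ_k(v) • b_{uv}`
(both annihilation operators pick up their site phase). [folklore] -/
theorem ffc_boost_conj_bondPair (k u v : TorusSite 2 L) :
    orbitalPhase (fun i : Orb (FermionTorus 2 L) => torusChar k (FermionTorus.toTorusSite (ofLex i).1)) *
        bondPair (FermionTorus.ofTorusSite u) (FermionTorus.ofTorusSite v) *
      (orbitalPhase (fun i : Orb (FermionTorus 2 L) =>
        torusChar k (FermionTorus.toTorusSite (ofLex i).1)))ᴴ =
      (conj (torusChar k u) * conj (torusChar k v)) •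
        bondPair (FermionTorus.ofTorusSite u) (FermionTorus.ofTorusSite v) := by
  have hg := ffc_norm_boostPhase L k
  have key : ∀ X : Matrix (Finset (Orb (FermionTorus 2 L))) (Finset (Orb (FermionTorus 2 L))) ℂ,
      orbitalPhase (fun i : Orb (FermionTorus 2 L) =>
            torusChar k (FermionTorus.toTorusSite (ofLex i).1)) * X *
          (orbitalPhase (fun i : Orb (FermionTorus 2 L) =>
            torusChar k (FermionTorus.toTorusSite (ofLex i).1)))ᴴ =
        orbitalPhaseAut hg X := fun X => (orbitalPhaseAut_apply hg X).symm
  rw [key, bondPair, map_sub, map_mul, map_mul, ← key, ← key, ← key, ← key,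
    ffc_boost_conj_annihilation, ffc_boost_conj_annihilation, ffc_boost_conj_annihilation,
    ffc_boost_conj_annihilation, smul_mul_smul, smul_mul_smul, smul_sub]

/-- **Boost of the local pair**: `W_k P_x W_kᴴ = conj χ_{2k}(x) • (P_x + C_x)`, where the bond
correction `C_x = Σ_{e ∈ {0,±e₁,±e₂}} (g e/√2)(conj χ_k(e) - 1) • b_{x,x+e}` collects the relative
phases `conj χ_k(e) - 1` of the partner sites (`= 0` for `e = 0` and for the steps orthogonal to
`k`; `O(|k| / L)` in general): a charge-`2` operator is boosted by `2k`. [folklore] -/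
theorem ffc_boost_conj_localPair (g : Site 2 → ℝ) (k x : TorusSite 2 L) :
    orbitalPhase (fun i : Orb (FermionTorus 2 L) => torusChar k (FermionTorus.toTorusSite (ofLex i).1)) *
        localPair g L x *
      (orbitalPhase (fun i : Orb (FermionTorus 2 L) =>
        torusChar k (FermionTorus.toTorusSite (ofLex i).1)))ᴴ =
      conj (torusChar (k + k) x) •
        (localPair g L x +
          ∑ e ∈ insert (0 : Site 2) unitSteps,
            (((g e / Real.sqrt 2 : ℝ) : ℂ) * (conj (torusChar k (Torus.proj L e)) - 1)) •
              bondPair (FermionTorus.ofTorusSite x) (FermionTorus.ofTorusSite (x + Torus.proj L e))) := by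
  have hg := ffc_norm_boostPhase L k
  have key : ∀ X : Matrix (Finset (Orb (FermionTorus 2 L))) (Finset (Orb (FermionTorus 2 L))) ℂ,
      orbitalPhase (fun i : Orb (FermionTorus 2 L) =>
            torusChar k (FermionTorus.toTorusSite (ofLex i).1)) * X *
          (orbitalPhase (fun i : Orb (FermionTorus 2 L) =>
            torusChar k (FermionTorus.toTorusSite (ofLex i).1)))ᴴ =
        orbitalPhaseAut hg X := fun X => (orbitalPhaseAut_apply hg X).symm
  rw [key, localPair_eq_sum_bondPair, map_sum, smul_add, Finset.smul_sum, Finset.smul_sum,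
    ← Finset.sum_add_distrib]
  refine Finset.sum_congr rfl fun e _ => ?_
  rw [map_smul, ← key, ffc_boost_conj_bondPair, smul_smul, smul_smul, smul_smul, ← add_smul,
    torusChar_add_right, ffc_torusChar_add_left, map_mul, map_mul]
  congr 1
  ring

/-- **Boost of the pair field**: `W_k Δ_g W_kᴴ = Δ_g(2k) + Σ_x conj χ_{2k}(x) • C_x` — the zero
mode of the boosted pair field is the mode `2k` of the pair field (`pairFieldAt g L (k + k)`), up to
the bond correction. [folklore] -/
theorem ffc_boost_conj_pairField (g : Site 2 → ℝ) (k : TorusSite 2 L) :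
    orbitalPhase (fun i : Orb (FermionTorus 2 L) => torusChar k (FermionTorus.toTorusSite (ofLex i).1)) *
        pairField g L *
      (orbitalPhase (fun i : Orb (FermionTorus 2 L) =>
        torusChar k (FermionTorus.toTorusSite (ofLex i).1)))ᴴ =
      pairFieldAt g L (k + k) +
        ∑ x : TorusSite 2 L, conj (torusChar (k + k) x) •
          ∑ e ∈ insert (0 : Site 2) unitSteps,
            (((g e / Real.sqrt 2 : ℝ) : ℂ) * (conj (torusChar k (Torus.proj L e)) - 1)) •
              bondPair (FermionTorus.ofTorusSite x) (FermionTorus.ofTorusSite (x + Torus.proj L e)) := by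
  rw [pairField, Finset.mul_sum, Finset.sum_mul, pairFieldAt_eq_sum_torusChar,
    ← Finset.sum_add_distrib]
  refine Finset.sum_congr rfl fun x _ => ?_
  rw [ffc_boost_conj_localPair, smul_add]

/-! ### Norm bookkeeping -/

/-- **Norm of the bond correction of the boosted pair field**:
`‖Σ_x conj χ_{2k}(x) • C_x‖ ≤ L² · 2 Σ_e |g e/√2| ‖χ_k(e) - 1‖` (`‖b_{uv}‖ ≤ 2`, `|χ| = 1`).
[folklore] -/
theorem ffc_norm_boostCorrection_le (g : Site 2 → ℝ) (k : TorusSite 2 L) :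
    ‖∑ x : TorusSite 2 L, conj (torusChar (k + k) x) •
        ∑ e ∈ insert (0 : Site 2) unitSteps,
          (((g e / Real.sqrt 2 : ℝ) : ℂ) * (conj (torusChar k (Torus.proj L e)) - 1)) •
            bondPair (FermionTorus.ofTorusSite x) (FermionTorus.ofTorusSite (x + Torus.proj L e))‖ ≤
      (L : ℝ) ^ 2 * (2 * ∑ e ∈ insert (0 : Site 2) unitSteps,
        |g e / Real.sqrt 2| * ‖torusChar k (Torus.proj L e) - 1‖) := by
  have hconj : ∀ z : ℂ, ‖conj z - 1‖ = ‖z - 1‖ := fun z => by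
    rw [← Complex.norm_conj (z - 1), map_sub, map_one]
  have hterm : ∀ x : TorusSite 2 L,
      ‖conj (torusChar (k + k) x) •
        ∑ e ∈ insert (0 : Site 2) unitSteps,
          (((g e / Real.sqrt 2 : ℝ) : ℂ) * (conj (torusChar k (Torus.proj L e)) - 1)) •
            bondPair (FermionTorus.ofTorusSite x) (FermionTorus.ofTorusSite (x + Torus.proj L e))‖ ≤
        2 * ∑ e ∈ insert (0 : Site 2) unitSteps, |g e / Real.sqrt 2| * ‖torusChar k (Torus.proj L e) - 1‖ := by
    intro x
    rw [norm_smul, Complex.norm_conj, norm_torusChar, one_mul, Finset.mul_sum]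
    refine (norm_sum_le _ _).trans (Finset.sum_le_sum fun e _ => ?_)
    rw [norm_smul, norm_mul, Complex.norm_real, Real.norm_eq_abs, hconj]
    have hb := norm_bondPair_le_two (FermionTorus.ofTorusSite x)
      (FermionTorus.ofTorusSite (x + Torus.proj L e))
    have h0 : 0 ≤ |g e / Real.sqrt 2| * ‖torusChar k (Torus.proj L e) - 1‖ := by positivity
    calc |g e / Real.sqrt 2| * ‖torusChar k (Torus.proj L e) - 1‖ *
          ‖bondPair (FermionTorus.ofTorusSite x) (FermionTorus.ofTorusSite (x + Torus.proj L e))‖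
        ≤ |g e / Real.sqrt 2| * ‖torusChar k (Torus.proj L e) - 1‖ * 2 :=
          mul_le_mul_of_nonneg_left hb h0
      _ = 2 * (|g e / Real.sqrt 2| * ‖torusChar k (Torus.proj L e) - 1‖) := by ring
  refine (norm_sum_le _ _).trans ?_
  calc ∑ x : TorusSite 2 L, ‖conj (torusChar (k + k) x) •
          ∑ e ∈ insert (0 : Site 2) unitSteps,
            (((g e / Real.sqrt 2 : ℝ) : ℂ) * (conj (torusChar k (Torus.proj L e)) - 1)) •
              bondPair (FermionTorus.ofTorusSite x) (FermionTorus.ofTorusSite (x + Torus.proj L e))‖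
      ≤ ∑ _x : TorusSite 2 L, 2 * ∑ e ∈ insert (0 : Site 2) unitSteps,
          |g e / Real.sqrt 2| * ‖torusChar k (Torus.proj L e) - 1‖ :=
        Finset.sum_le_sum fun x _ => hterm x
    _ = (L : ℝ) ^ 2 * (2 * ∑ e ∈ insert (0 : Site 2) unitSteps,
          |g e / Real.sqrt 2| * ‖torusChar k (Torus.proj L e) - 1‖) := by
        rw [Finset.sum_const, Finset.card_univ, card_torusSite_two L, nsmul_eq_mul]
        push_cast
        ring

/-- Parallelogram bound: `‖u + w‖² ≤ 2‖u‖² + 2‖w‖²`, in `dotProduct` form. [folklore] -/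
theorem ffc_re_star_dotProduct_add_self_le {ι : Type*} [Fintype ι] (u w : ι → ℂ) :
    (star (u + w) ⬝ᵥ (u + w)).re ≤ 2 * (star u ⬝ᵥ u).re + 2 * (star w ⬝ᵥ w).re := by
  have h : star (u + w) ⬝ᵥ (u + w) + star (u - w) ⬝ᵥ (u - w) =
      2 * (star u ⬝ᵥ u) + 2 * (star w ⬝ᵥ w) := by
    simp only [star_add, star_sub, add_dotProduct, sub_dotProduct, dotProduct_add, dotProduct_sub]
    ring
  have h' := congrArg Complex.re h
  simp only [Complex.add_re, Complex.mul_re, Complex.re_ofNat, Complex.im_ofNat, zero_mul,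
    sub_zero] at h'
  have h0 : 0 ≤ (star (u - w) ⬝ᵥ (u - w)).re :=
    (Complex.nonneg_iff.1 (dotProduct_star_self_nonneg _)).1
  linarith

/-- `‖A v‖² ≤ ‖A‖² ‖v‖²` in `dotProduct` form (`ℓ²` operator norm): `Re ⟨A v, A v⟩ = Re ⟨v, Aᴴ A v⟩ ≤
‖Aᴴ A‖ Re ⟨v, v⟩`. [folklore] -/
theorem ffc_re_star_mulVec_dotProduct_mulVec_le_norm_sq {ι : Type*} [Fintype ι] [DecidableEq ι]
    (A : Matrix ι ι ℂ) (v : ι → ℂ) :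
    (star (A *ᵥ v) ⬝ᵥ A *ᵥ v).re ≤ ‖A‖ ^ 2 * (star v ⬝ᵥ v).re := by
  rw [← ffc_star_dotProduct_conjTranspose_mul_mulVec, sq, ← l2_opNorm_conjTranspose_mul_self]
  exact (le_abs_self _).trans (Matrix.abs_re_star_dotProduct_mulVec_le (Aᴴ * A) v)

/-! ### The pair order of a boosted state -/

/-- **The `k = 0` pair order of a boosted state is controlled by the structure factor at `2k`.**
For every Fock vector `ψ`, every form factor `g` and every boost momentum `k`,
`L⁻⁴ ‖Δ_g W_kᴴ ψ‖² ≤ 2 S_ψ(2k) / L² + 2 (2 Σ_e |g e/√2| ‖χ_k(e) - 1‖)² ‖ψ‖²`, where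
`S_ψ(m) = ‖Δ_g(m) ψ‖² / L²` is the pair structure factor (`pairStructureFactor`) and `W_k` the gauge
transformation `orbitalPhase (x, σ) ↦ χ_k(x)`. Proof: `Δ_g W_kᴴ ψ = W_kᴴ (W_k Δ_g W_kᴴ) ψ`,
`ffc_boost_conj_pairField`, the parallelogram bound and `ffc_norm_boostCorrection_le`. With
`Σ_m S_ψ(m) = Σ_x ‖P_x ψ‖² ≤ 32 L²` (`sum_pairStructureFactor`) this is the pigeonhole input of the
route's necessary-pole lemma: along the Lieb–Schultz–Mattis boosts `k = (j, 0)`, `j ≤ J₀`, the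
average `k = 0` pair order of the boosted ground state is `≤ 64/J₀ + O(J₀²/L²)`.
[cite: LiebSchultzMattisAP1961, Appendix B] -/
theorem ffc_twisted_pairOrder_le (g : Site 2 → ℝ) (k : TorusSite 2 L)
    (ψ : Fock (Orb (FermionTorus 2 L))) :
    (star ((orbitalPhase (fun i : Orb (FermionTorus 2 L) =>
        torusChar k (FermionTorus.toTorusSite (ofLex i).1)))ᴴ *ᵥ ψ) ⬝ᵥ
      ((1 / (L : ℂ) ^ 4) • ((pairField g L)ᴴ * pairField g L)) *ᵥ
        ((orbitalPhase (fun i : Orb (FermionTorus 2 L) =>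
          torusChar k (FermionTorus.toTorusSite (ofLex i).1)))ᴴ *ᵥ ψ)).re ≤
      2 * pairStructureFactor g L ψ (k + k) / (L : ℝ) ^ 2 +
        2 * (2 * ∑ e ∈ insert (0 : Site 2) unitSteps,
          |g e / Real.sqrt 2| * ‖torusChar k (Torus.proj L e) - 1‖) ^ 2 * (star ψ ⬝ᵥ ψ).re := by
  set W : Matrix (Finset (Orb (FermionTorus 2 L))) (Finset (Orb (FermionTorus 2 L))) ℂ :=
    orbitalPhase (fun i : Orb (FermionTorus 2 L) =>
      torusChar k (FermionTorus.toTorusSite (ofLex i).1)) with hW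
  have hg := ffc_norm_boostPhase L k
  have hWl : ∀ v, Wᴴ *ᵥ (W *ᵥ v) = v := orbitalPhase_conjTranspose_mulVec_mulVec hg
  have hWr : ∀ v, W *ᵥ (Wᴴ *ᵥ v) = v := orbitalPhase_mulVec_conjTranspose_mulVec hg
  -- `Δ Wᴴ ψ = Wᴴ ((W Δ Wᴴ) ψ)`
  have hΔ : pairField g L *ᵥ (Wᴴ *ᵥ ψ) = Wᴴ *ᵥ ((W * pairField g L * Wᴴ) *ᵥ ψ) := by
    rw [← mulVec_mulVec, ← mulVec_mulVec, hWl]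
  have hL0 : (L : ℝ) ≠ 0 := Nat.cast_ne_zero.2 (NeZero.ne L)
  have hc : (1 / (L : ℂ) ^ 4) = (((1 / (L : ℝ) ^ 4 : ℝ)) : ℂ) := by push_cast; rfl
  rw [smul_mulVec, dotProduct_smul, smul_eq_mul, hc, Complex.re_ofReal_mul,
    ffc_star_dotProduct_conjTranspose_mul_mulVec, hΔ,
    ffc_star_conjTranspose_mulVec_dotProduct_conjTranspose_mulVec hWr, hW,
    ffc_boost_conj_pairField, add_mulVec]
  -- the two pieces
  set u := pairFieldAt g L (k + k) *ᵥ ψ with hu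
  set wv := (∑ x : TorusSite 2 L, conj (torusChar (k + k) x) •
      ∑ e ∈ insert (0 : Site 2) unitSteps,
        (((g e / Real.sqrt 2 : ℝ) : ℂ) * (conj (torusChar k (Torus.proj L e)) - 1)) •
          bondPair (FermionTorus.ofTorusSite x) (FermionTorus.ofTorusSite (x + Torus.proj L e))) *ᵥ ψ
    with hwv
  have hpar := ffc_re_star_dotProduct_add_self_le u wv
  have hu' : (star u ⬝ᵥ u).re = pairStructureFactor g L ψ (k + k) * (L : ℝ) ^ 2 := by
    rw [pairStructureFactor_apply, hu, div_mul_cancel₀ _ (pow_ne_zero 2 hL0)]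
  have hw' : (star wv ⬝ᵥ wv).re ≤ ((L : ℝ) ^ 2 * (2 * ∑ e ∈ insert (0 : Site 2) unitSteps,
      |g e / Real.sqrt 2| * ‖torusChar k (Torus.proj L e) - 1‖)) ^ 2 * (star ψ ⬝ᵥ ψ).re := by
    refine (ffc_re_star_mulVec_dotProduct_mulVec_le_norm_sq _ ψ).trans ?_
    refine mul_le_mul_of_nonneg_right ?_ (Complex.nonneg_iff.1 (dotProduct_star_self_nonneg _)).1
    exact pow_le_pow_left₀ (norm_nonneg _) (ffc_norm_boostCorrection_le L g k) 2
  have hψ0 : 0 ≤ (star ψ ⬝ᵥ ψ).re := (Complex.nonneg_iff.1 (dotProduct_star_self_nonneg _)).1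
  have hS0 : 0 ≤ pairStructureFactor g L ψ (k + k) := pairStructureFactor_nonneg _ _ _ _
  have hL4 : 0 < 1 / (L : ℝ) ^ 4 := by positivity
  -- assemble
  calc 1 / (L : ℝ) ^ 4 * (star (u + wv) ⬝ᵥ (u + wv)).re
      ≤ 1 / (L : ℝ) ^ 4 * (2 * (pairStructureFactor g L ψ (k + k) * (L : ℝ) ^ 2) +
          2 * (((L : ℝ) ^ 2 * (2 * ∑ e ∈ insert (0 : Site 2) unitSteps,
            |g e / Real.sqrt 2| * ‖torusChar k (Torus.proj L e) - 1‖)) ^ 2 * (star ψ ⬝ᵥ ψ).re)) := by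
        refine mul_le_mul_of_nonneg_left ?_ hL4.le
        rw [← hu']
        linarith
    _ = 2 * pairStructureFactor g L ψ (k + k) / (L : ℝ) ^ 2 +
        2 * (2 * ∑ e ∈ insert (0 : Site 2) unitSteps,
          |g e / Real.sqrt 2| * ‖torusChar k (Torus.proj L e) - 1‖) ^ 2 * (star ψ ⬝ᵥ ψ).re := by
        field_simp

end Boost

end Summit.HubbardSuperconductivity.HubbardSuperconductivity.Theorems
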